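import Literature.AlgebraicGeometry.Motives.JacobianAbelJacobiSum
import Literature.AlgebraicGeometry.Motives.SeparatedQuotient
import Literature.AlgebraicGeometry.Motives.AbelianVarietyLevelAdjointCalculus
import Literature.AlgebraicGeometry.Motives.AbelianVarietyHomDivisionOnPoints
import Literature.AlgebraicGeometry.Motives.AbelianVarietyWeilPairingAlongIsogeny
import Literature.AlgebraicGeometry.Motives.AlgPointsMapSurjectiveAlgClosed
import Literature.AlgebraicGeometry.Motives.CurveDivisorsFunctionField
import Literature.AlgebraicGeometry.Motives.CurveGeneralDivisorsNonempty
import HarnessLib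

/-!
# Naturality of Abel–Jacobi sums along a Galois cover: `aj_c(p^* E) = p^*(aj_{p c}(E))` for `deg E = 0`

Layer `Literature/AlgebraicGeometry/Motives`, namespace `Literature.AlgebraicGeometry.Motives.Jacobian`.
THEOREMS ONLY (no definition, no named fact, no instance, no `sorry`).  Leaf §2 (g4-nat) of the cell's road G4 =
[Lange2023] Lemma 4.4.4 → Cor. 4.4.5 → eq. (4.9) → Lemma 5.3.7 towards the named fact
`Jacobian.galoisCover_pullback_isWeilPairingAdjoint_norm` (letters of record: the pen's socket file v3).

For a Galois cover `p : X → Y = X/Δ` of smooth proper complex curves (`IsSepQuotient`), the pull-back `t = p^* : J_Y → J_X` pinned by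
`Nm_p ≫ t = Σ_δ δ_*` ([LangeRodriguez2022] Prop. 3.5.1 «`Nm_G = f^* ∘ Nm_f`»), a complex point `c` of `X` and a divisor `E` of degree
`0` on `Y`:  **`aj_c(p^* E) = t(aj_{p c}(E))`** (`ajSum_pullback_eq_map_of_pin`), where `aj_c(E) = ∏_P α_c(P)^{ord_P E}` is the
Abel–Jacobi sum (★ `Jacobian.ajSum`, [Lange2023] §4.1.3 / [Milne1986] §5).  The ramification input enters through two explicit binders,
the outputs of the leaf `Motives/GaloisCoverPointDivisorPullback` ([Hartshorne1977] IV.2 Prop. 2.2 `e_P = v_P(φ^* t)`, and «fibres are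
orbits»): `hram : ord_x(p^*E) = #Stab_Δ(x) · ord_{p x}(E)` and `hfib`.  Proof: for `q = p(w)` the pin and Lange's square
`N_f ∘ α_c = α_{f c} ∘ f` give `t(α_{pc}(q)) = ∏_δ δ_*(α_c w) = ∏_δ α_c(δw) · (∏_δ α_c(δc))⁻¹`, while `hram`/`hfib` give
`∏_{x ↦ q} α_c(x)^{ord_x p^*[q]} = ∏_δ α_c(δ w)`; the constant `∏_δ α_c(δ c)` drops out because `Σ_q ord_q E = deg E = 0`
(`CartierDivisor.degree_eq_sum_ordAt_pt`).

## References
* [Lange2023AbelianVarietiesComplex] H. Lange, *Abelian Varieties over the Complex Numbers* (2023), §4.5.2 eq. (4.9) (p. 227); §4.1.3.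
* [LangeRodriguez2022] H. Lange, R. E. Rodríguez, *Decomposition of Jacobians by Prym Varieties* (2022), §3.5.1 Prop. 3.5.1 (p. 65).
* [Milne1986JacobianVarieties] J. S. Milne, *Jacobian varieties* (1986), §5 (the maps `f^r : C^r → J`).
* [Hartshorne1977] R. Hartshorne, *Algebraic Geometry* (1977), IV.2 Prop. 2.2.
* [Fulton1998] W. Fulton, *Intersection Theory* (1998), Definition 1.4 (p. 13).
-/

set_option autoImplicit false

noncomputable section

universe u

open CategoryTheory AlgebraicGeometry

namespace Literature.AlgebraicGeometry.Motives

open scoped MonObj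

/-! ### The degree of a divisor on a smooth proper complex curve as a sum over complex points -/

/-- **`deg E = Σ_{q ∈ C(ℂ)} ord_q(E)`** for a Cartier divisor `E` on a smooth proper complex curve, the sum over any finite set of complex
points containing those of non-zero multiplicity (`deg E = Σ_x ord_x(E) [κ(x):ℂ]`, the generic point contributes `ord_η E = 0`, closed
points are complex points with `[κ(x):ℂ] = 1`). [cite: Fulton1998, Definition 1.4 (p. 13)] -/
theorem CartierDivisor.degree_eq_sum_ordAt_pt {C : SchemeOver ℂ} [IsIntegral C.left] [SmoothOfRelativeDimension 1 C.hom]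
    [IsProper C.hom] (E : CartierDivisor C.left) (s : Finset (AlgPoints C ℂ))
    (hs : ∀ q : AlgPoints C ℂ, E.ordAt q.pt ≠ 0 → q ∈ s) :
    CartierDivisor.degree C E = ∑ q ∈ s, E.ordAt q.pt := by
  classical
  haveI : Smooth C.hom := SmoothOfRelativeDimension.smooth 1 C.hom
  haveI : LocallyOfFiniteType C.hom := inferInstance
  -- residue degree `1` at complex points
  have hrd : ∀ q : AlgPoints C ℂ, ((toSpecOver C).left.residueDegree q.pt : ℤ) = 1 := by
    intro q
    have hw : q.left ≫ C.hom = 𝟙 _ := by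
      rw [Over.w q]
      change Spec.map (CommRingCat.ofHom (algebraMap ℂ ℂ)) = 𝟙 _
      rw [Algebra.algebraMap_self, CommRingCat.ofHom_id, Spec.map_id]
    have h : C.hom.residueDegree q.pt = 1 := FieldPoint.residueDegree_eq_one_of_section C.hom hw
    change ((C.hom.residueDegree q.pt : ℕ) : ℤ) = 1
    rw [h]; rfl
  -- `pt` is injective on complex points
  have hinj : Set.InjOn (fun q : AlgPoints C ℂ => q.pt) (s : Set (AlgPoints C ℂ)) :=
    fun q _ q' _ h => AlgPoints.eq_of_pt_eq h
  rw [CartierDivisor.degree_eq_finsum]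
  have hsupp : (Function.support fun x : C.left => E.ordAt x * ((toSpecOver C).left.residueDegree x : ℤ)) ⊆
      ((s.image fun q : AlgPoints C ℂ => q.pt : Finset C.left) : Set C.left) := by
    intro x hx
    rw [Function.mem_support] at hx
    have hx0 : E.ordAt x ≠ 0 := fun h => hx (by rw [h, zero_mul])
    have hxη : x ≠ genericPoint C.left := fun h => hx0 (by rw [h]; exact CurvePlaces.ordAt_genericPoint C E)
    obtain ⟨q, hq⟩ := AlgPoints.exists_pt_eq_of_isClosed_singleton (X := C) (CurvePlaces.isClosed_singleton C hxη)
    rw [Finset.coe_image]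
    exact ⟨q, Finset.mem_coe.2 (hs q (by rw [hq]; exact hx0)), hq⟩
  rw [finsum_eq_sum_of_support_subset _ hsupp, Finset.sum_image hinj]
  refine Finset.sum_congr rfl fun q _ => ?_
  rw [hrd q, mul_one]

namespace Jacobian

/-! ### Points of Jacobians: the norm square, change of base point, sums of homomorphisms -/

section Points

variable {k : Type u} [Field k] {C C' : SchemeOver k} (𝒥 : Jacobian C) (𝒥' : Jacobian C')

/-- **Lange's square on points: `Nm_f(α_c(P)) = α_{f c}(f P)`** (★ `abelJacobi_comp_pushforward` read on a rational point).
[cite: Lange2023AbelianVarietiesComplex, §4.5.2 eq. (4.9) (p. 227)] -/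
theorem map_pushforward_map_abelJacobi (f : C ⟶ C') (c P : AlgPoints C k) :
    AlgPoints.map (𝒥.pushforward 𝒥' f).hom.hom.hom (AlgPoints.map (𝒥.abelJacobi c) P) =
      AlgPoints.map (𝒥'.abelJacobi (AlgPoints.map f c)) (AlgPoints.map f P) := by
  rw [AlgPoints.map_apply, AlgPoints.map_apply, AlgPoints.map_apply, AlgPoints.map_apply, Category.assoc,
    abelJacobi_comp_pushforward, Category.assoc]
  rfl

/-- **Change of base point on points: `α_{c′}(P) = α_c(P) · α_c(c′)⁻¹`** (★ `abelJacobi_eq_mul_const`). [cite: Milne1986JacobianVarieties, §5 (the maps f^r : C^r → J)] -/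
theorem map_abelJacobi_basePoint (c c' P : AlgPoints C k) :
    AlgPoints.map (𝒥.abelJacobi c') P = AlgPoints.map (𝒥.abelJacobi c) P * (AlgPoints.map (𝒥.abelJacobi c) c')⁻¹ := by
  rw [AlgPoints.map_apply, AlgPoints.map_apply, AlgPoints.map_apply, 𝒥.abelJacobi_eq_mul_const c c', MonObj.comp_mul]
  congr 1
  rw [← Category.assoc, point_comp_toSpecOver, Category.id_comp]

end Points

/-! ### Galois action on complex points: the action laws and the stabiliser count along an orbit -/

section Action

variable {k : Type u} [Field k] {X Y : SchemeOver k} {Δ : Type} [Group Δ] (act : Δ →* Aut X)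

/-- `(act (a b))·w = (act a)·((act b)·w)` on rational points (the group `Aut X` composes from the right). [cite: MumfordAV1970, §7 Thm. p. 66 (1)] -/
theorem map_act_mul (a b : Δ) (w : AlgPoints X k) :
    AlgPoints.map (act (a * b)).hom w = AlgPoints.map (act a).hom (AlgPoints.map (act b).hom w) := by
  rw [map_mul, ← AlgPoints.map_comp_apply]
  rfl

/-- `(act 1)·w = w`. [cite: MumfordAV1970, §7 Thm. p. 66 (1)] -/
theorem map_act_one (w : AlgPoints X k) : AlgPoints.map (act 1).hom w = w := by
  rw [map_one]
  exact AlgPoints.map_id_apply w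

/-- **Along an orbit the stabiliser-coset counts agree with the stabiliser order**: if `x = (act δ₀)·w` then
`#{δ | (act δ)·x = x} = #{δ | (act δ)·w = x}` (right multiplication by `δ₀`). [cite: MumfordAV1970, §7 Thm. p. 66 (1)] -/
theorem card_stabilizer_eq_card_transporter {w x : AlgPoints X k} {δ₀ : Δ} (h : AlgPoints.map (act δ₀).hom w = x) :
    Nat.card {δ : Δ // AlgPoints.map (act δ).hom x = x} = Nat.card {δ : Δ // AlgPoints.map (act δ).hom w = x} := by
  refine Nat.card_congr ?_
  refine
    { toFun := fun δ => ⟨δ.1 * δ₀, by rw [map_act_mul, h]; exact δ.2⟩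
      invFun := fun δ => ⟨δ.1 * δ₀⁻¹, ?_⟩
      left_inv := fun δ => Subtype.ext (by simp)
      right_inv := fun δ => Subtype.ext (by simp) }
  have hw : AlgPoints.map (act δ₀⁻¹).hom x = w := by
    rw [← h, ← map_act_mul, inv_mul_cancel, map_act_one]
  rw [map_act_mul, hw]
  exact δ.2

/-- The `Δ`-orbit of a complex point maps into the fibre of an invariant morphism: `p((act δ)·w) = p(w)`. [cite: MumfordAV1970, §7 Thm. p. 66 (1)] -/
theorem map_map_act_eq_of_invariant {p : X ⟶ Y} (hp : ∀ δ : Δ, (act δ).hom ≫ p = p) (δ : Δ) (w : AlgPoints X k) :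
    AlgPoints.map p (AlgPoints.map (act δ).hom w) = AlgPoints.map p w := by
  rw [← AlgPoints.map_comp_apply, hp]

end Action

/-! ### §2 (g4-nat): `aj_c(p^* E) = t(aj_{p c}(E))` -/

section Naturality

variable {X Y : SchemeOver ℂ} (𝒥X : Jacobian X) (𝒥Y : Jacobian Y)

/-- A product of integer powers of one element. [folklore] -/
private theorem prod_zpow_eq_zpow_sum {G : Type*} [CommGroup G] {α : Type*} (s : Finset α) (f : α → ℤ) (a : G) :
    ∏ i ∈ s, a ^ f i = a ^ ∑ i ∈ s, f i := by
  classical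
  induction s using Finset.induction_on with
  | empty => simp
  | insert i s hi ih => rw [Finset.prod_insert hi, Finset.sum_insert hi, ih, zpow_add]

/-- **§2 (g4-nat): naturality of the Abel–Jacobi sum along a Galois cover.**  For a Galois cover `p : X → Y = X/Δ` of smooth proper
complex curves (`act` a finite group of automorphisms of `X`, `p` its quotient for separated test objects), `t : J_Y → J_X` pinned by
`Nm_p ≫ t = Σ_δ δ_*` (= `p^*`), a complex point `c` of `X` and a Cartier divisor `E` of degree `0` on `Y`:
`aj_c(p^* E) = t(aj_{p c}(E))`.  The ramification of `p` enters only through the two binders `hram` (`ord_x(p^*E) = #Stab(x) · ord_{px}(E)`,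
[Hartshorne1977] IV.2 Prop. 2.2 for a Galois cover) and `hfib` (the fibres of `p(ℂ)` are `Δ`-orbits), both theorems of the leaf
`Motives/GaloisCoverPointDivisorPullback`.  [cite: Lange2023AbelianVarietiesComplex, §4.5.2 eq. (4.9) (p. 227)]
[cite: LangeRodriguez2022, §3.5.1 Prop. 3.5.1 (p. 65)] [cite: Hartshorne1977, IV.2 Prop. 2.2] -/
theorem ajSum_pullback_eq_map_of_pin [IsIntegral X.left] [IsLocallyNoetherian X.left] [SmoothOfRelativeDimension 1 X.hom]
    [IsProper X.hom] [IsIntegral Y.left] [IsLocallyNoetherian Y.left] [SmoothOfRelativeDimension 1 Y.hom] [IsProper Y.hom]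
    (Δ : Type) [Group Δ] [Fintype Δ] (act : Δ →* Aut X) (_hact : Function.Injective act)
    (p : X ⟶ Y) (hp : IsSepQuotient (fun δ : Δ => act δ) p) [IsDominant p.left]
    (t : 𝒥Y.J ⟶ 𝒥X.J) (ht : 𝒥X.pushforward 𝒥Y p ≫ t = ∑ δ : Δ, 𝒥X.pushforward 𝒥X (act δ).hom)
    (hram : ∀ (E : CartierDivisor Y.left) (x : AlgPoints X ℂ),
      (E.pullback p.left).ordAt x.pt = Nat.card {δ : Δ // AlgPoints.map (act δ).hom x = x} * E.ordAt (AlgPoints.map p x).pt)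
    (hfib : ∀ w x : AlgPoints X ℂ, AlgPoints.map p w = AlgPoints.map p x → ∃ δ : Δ, AlgPoints.map (act δ).hom w = x)
    (c : AlgPoints X ℂ) (E : CartierDivisor Y.left) (hE : CartierDivisor.degree Y E = 0) :
    𝒥X.ajSum c (E.pullback p.left) = AlgPoints.map t.hom.hom.hom (𝒥Y.ajSum (AlgPoints.map p c) E) := by
  classical
  haveI : Smooth X.hom := SmoothOfRelativeDimension.smooth 1 X.hom
  haveI : Smooth Y.hom := SmoothOfRelativeDimension.smooth 1 Y.hom
  haveI : LocallyOfFiniteType X.hom := inferInstance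
  haveI : LocallyOfFiniteType Y.hom := inferInstance
  -- notation
  set α : AlgPoints X ℂ → 𝒥X.J.Points ℂ := fun x => AlgPoints.map (𝒥X.abelJacobi c) x with hα
  set e : AlgPoints X ℂ → ℤ := fun x => (Nat.card {δ : Δ // AlgPoints.map (act δ).hom x = x} : ℤ) with he
  set n : AlgPoints Y ℂ → ℤ := fun q => E.ordAt q.pt with hn
  -- `p` is surjective on complex points
  have hsurj : Function.Surjective (AlgPoints.map (L := ℂ) p) := by
    haveI : UniversallyClosed (p.left ≫ Y.hom) := by rw [Over.w p]; infer_instance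
    haveI : UniversallyClosed p.left := UniversallyClosed.of_comp_of_isSeparated p.left Y.hom
    haveI : Surjective p.left := surjective_of_isDominant_of_isClosed_range p.left p.left.isClosedMap.isClosed_range
    exact AlgPoints.map_surjective_of_surjective_of_isAlgClosed' p
  choose w hw using hsurj
  -- the finite set of complex points of `Y` where `E` has non-zero multiplicity
  set S : Finset (AlgPoints Y ℂ) := (Jacobian.finite_setOf_ordAt_pt_ne_zero (C := Y) E).toFinset with hS
  have hSmem : ∀ q : AlgPoints Y ℂ, E.ordAt q.pt ≠ 0 → q ∈ S := fun q hq => by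
    rw [hS, Set.Finite.mem_toFinset]; exact hq
  -- the orbit of `w q` as a finset, and its basic properties
  set orb : AlgPoints Y ℂ → Finset (AlgPoints X ℂ) := fun q => Finset.univ.image fun δ : Δ => AlgPoints.map (act δ).hom (w q)
    with horb
  have hp1 : ∀ δ : Δ, (act δ).hom ≫ p = p := hp.1
  have horb_fib : ∀ (q : AlgPoints Y ℂ) (x : AlgPoints X ℂ), x ∈ orb q ↔ AlgPoints.map p x = q := by
    intro q x
    rw [horb, Finset.mem_image]
    constructor
    · rintro ⟨δ, -, rfl⟩
      rw [map_map_act_eq_of_invariant act hp1, hw]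
    · intro hx
      obtain ⟨δ, hδ⟩ := hfib (w q) x (by rw [hw, hx])
      exact ⟨δ, Finset.mem_univ _, hδ⟩
  -- LHS as a finite product over `FX = ⋃_{q ∈ S} orb q`
  set FX : Finset (AlgPoints X ℂ) := S.biUnion orb with hFX
  have hLHS : 𝒥X.ajSum c (E.pullback p.left) = ∏ x ∈ FX, α x ^ (e x * n (AlgPoints.map p x)) := by
    rw [𝒥X.ajSum_eq_finset_prod c (E.pullback p.left) FX ?_]
    · exact Finset.prod_congr rfl fun x _ => by rw [hram E x]
    · intro x hx
      rw [hram E x] at hx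
      have hn0 : E.ordAt (AlgPoints.map p x).pt ≠ 0 := fun h => hx (by rw [h, mul_zero])
      rw [hFX, Finset.mem_biUnion]
      exact ⟨AlgPoints.map p x, hSmem _ hn0, (horb_fib _ x).2 rfl⟩
  -- regroup `FX` by the fibres: `∏_{x ∈ FX} = ∏_{q ∈ S} ∏_{x ∈ orb q}`
  have hdisj : (S : Set (AlgPoints Y ℂ)).PairwiseDisjoint orb := by
    intro q _ q' _ hqq'
    rw [Function.onFun, Finset.disjoint_left]
    intro x hx hx'
    exact hqq' (((horb_fib q x).1 hx).symm.trans ((horb_fib q' x).1 hx'))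
  have hLHS' : ∏ x ∈ FX, α x ^ (e x * n (AlgPoints.map p x)) = ∏ q ∈ S, (∏ x ∈ orb q, α x ^ e x) ^ n q := by
    rw [hFX, Finset.prod_biUnion hdisj]
    refine Finset.prod_congr rfl fun q _ => ?_
    rw [← Finset.prod_zpow]
    refine Finset.prod_congr rfl fun x hx => ?_
    rw [(horb_fib q x).1 hx, zpow_mul]
  -- the orbit product: `∏_{x ∈ orb q} α(x)^{e x} = ∏_δ α((act δ)·(w q))`
  have horb_prod : ∀ q : AlgPoints Y ℂ, ∏ x ∈ orb q, α x ^ e x = ∏ δ : Δ, α (AlgPoints.map (act δ).hom (w q)) := by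
    intro q
    rw [horb, Finset.prod_comp α fun δ : Δ => AlgPoints.map (act δ).hom (w q)]
    refine Finset.prod_congr rfl fun x hx => ?_
    obtain ⟨δ₀, -, hδ₀⟩ := Finset.mem_image.1 hx
    rw [← zpow_natCast]
    congr 1
    rw [he]
    simp only
    rw [card_stabilizer_eq_card_transporter act hδ₀, Nat.card_eq_fintype_card, Fintype.card_subtype]
  -- RHS: `t(aj_{pc}(E)) = ∏_{q ∈ S} t(α_{pc}(q))^{n q}`
  have hhom : ∀ (a b : 𝒥Y.J.Points ℂ), AlgPoints.map t.hom.hom.hom (a * b) =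
      AlgPoints.map t.hom.hom.hom a * AlgPoints.map t.hom.hom.hom b := AbelianVariety.map_hom_mul t
  let T : 𝒥Y.J.Points ℂ →* 𝒥X.J.Points ℂ := MonoidHom.mk' (AlgPoints.map t.hom.hom.hom) hhom
  have hT : ∀ a, T a = AlgPoints.map t.hom.hom.hom a := fun _ => rfl
  have hRHS : AlgPoints.map t.hom.hom.hom (𝒥Y.ajSum (AlgPoints.map p c) E) =
      ∏ q ∈ S, (AlgPoints.map t.hom.hom.hom (AlgPoints.map (𝒥Y.abelJacobi (AlgPoints.map p c)) q)) ^ n q := by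
    rw [𝒥Y.ajSum_eq_finset_prod (AlgPoints.map p c) E S hSmem, ← hT, map_prod]
    refine Finset.prod_congr rfl fun q _ => ?_
    rw [map_zpow]
    rfl
  -- the pin on points: `t(α_{pc}(p w)) = ∏_δ α((act δ)·w) · α((act δ)·c)⁻¹`
  set K : 𝒥X.J.Points ℂ := ∏ δ : Δ, α (AlgPoints.map (act δ).hom c) with hK
  have hpin : ∀ q : AlgPoints Y ℂ, AlgPoints.map t.hom.hom.hom (AlgPoints.map (𝒥Y.abelJacobi (AlgPoints.map p c)) q) =
      (∏ δ : Δ, α (AlgPoints.map (act δ).hom (w q))) * K⁻¹ := by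
    intro q
    conv_lhs => rw [← hw q]
    rw [← map_pushforward_map_abelJacobi 𝒥X 𝒥Y p c (w q), ← AbelianVariety.map_hom_comp_apply, ht,
      AbelianVariety.map_hom_sum_apply, hK, ← Finset.prod_inv_distrib, ← Finset.prod_mul_distrib]
    refine Finset.prod_congr rfl fun δ _ => ?_
    rw [map_pushforward_map_abelJacobi 𝒥X 𝒥X (act δ).hom c (w q), map_abelJacobi_basePoint 𝒥X c]
  -- assemble
  have hsum : ∑ q ∈ S, n q = 0 := by
    rw [← hE, CartierDivisor.degree_eq_sum_ordAt_pt E S hSmem]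
  rw [hLHS, hLHS', hRHS]
  simp_rw [hpin, mul_zpow, Finset.prod_mul_distrib, prod_zpow_eq_zpow_sum, hsum, zpow_zero, mul_one]
  exact Finset.prod_congr rfl fun q _ => by rw [horb_prod]

end Naturality

end Jacobian

end Literature.AlgebraicGeometry.Motives

end
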